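import Summits.BirchSwinnertonDyer.BirchSwinnertonDyer.Theorems.EisensteinPrimesMazurMCOnX1RankZeroInterludeResidualGL1Continuity
import Summits.BirchSwinnertonDyer.BirchSwinnertonDyer.Theorems.EisensteinPrimesMazurMCOnX1RankZeroInterludeResidualGL1Tame
import Summits.BirchSwinnertonDyer.BirchSwinnertonDyer.Theorems.EisensteinPrimesMazurMCOnX1RankZeroInterludeRoadBGL1Reduction
import Summits.BirchSwinnertonDyer.BirchSwinnertonDyer.Theorems.AlignedTransportAtTwoMainConjectureOfRankZeroBSDAtTwoFineRoadInfRes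
import Literature.NumberTheory.IwasawaTheory.ClassicalMuVanishesUnramifiedClasses
import Literature.NumberTheory.EllipticCurves.ZpExtensionRestrictCyclotomic
import Literature.NumberTheory.EllipticCurves.GreenbergVatsal2000.UnramifiedOutsideFinite
import Literature.NumberTheory.EllipticCurves.HeegnerPoints
import Literature.NumberTheory.ComplexMultiplication.TateHalfTransferInducedType
import Literature.NumberTheory.GaloisRepresentations.ArtinRestriction
import Literature.NumberTheory.GaloisRepresentations.AbsIntegersEquiv
import Literature.NumberTheory.GaloisRepresentations.GaloisSubgroups
import Literature.NumberTheory.GaloisRepresentations.DecompositionGroupOfCompletion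
import Literature.NumberTheory.Automorphic.LanglandsTetrahedral
import HarnessLib

/-!
# Route `EisensteinPrimes`, crux 5 `MazurMCOnX1RankZero` (stmt-BirchSwinnertonDyer-19035), line `interlude_with_torsion`,
# node (B3) `ResidualGL1FinitenessOdd`: the input **[Unr]** of `residualGL1FinitenessOdd_of_unr_even'`
# (`Theorems/…InterludeResidualGL1Tame`) REDUCED TO THE TWO PRINTED THEOREMS of classical Iwasawa theory —
# Ferrero–Washington (`ferreroWashington1979_classicalMuVanishes`) and "`μ = 0` ⇒ finitely many everywhere-unramified
# classes" (`classicalMuVanishes_finite_unramifiedClasses`) — for a GENERAL residual character (not only the trivial one).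

Ideator workfile (bsd-idea-11 g17, lens `nearmiss`; publish-only, W-71/W-79).  BSD is not proved here; no statement of the
summit is proved by this file.  What is proved (sorry-free):

* §1 `PrimeOrder`: on a module `M` of prime order every group element acts by an integer scalar.
* §2 `Transport` (generic, for a finite extension `F/K` of number fields of degree prime to `p` inside which `Γ_F` acts on `M`
  through `res : Γ_F → Γ_K`): the pull-back `resField : H¹(K_∞, M) → H¹(F_∞, M)` along `res : Gal(F̄/F_∞) → Gal(K̄/K_∞)`
  (`F_∞ = F·K_∞`, `κ_F = κ ∘ res`), with
  - `resField_mem_unramifiedKer`: an everywhere-unramified class (Greenberg–Vatsal kernels `unramifiedKer`, all places, all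
    conjugates) pulls back to an everywhere-unramified class — inertia groups of `F` restrict into inertia groups of `K`
    (`absGaloisRestrict_mem_inertia_comap`), and a GV-unramified class dies on EVERY inertia group above `v`
    (`resOfLe_inertia_inf_eq_zero_of_forall`, the Greenberg–Vatsal transitivity argument);
  - `finite_preimage_resField`: when `res(Γ_F) ⊴ Γ_K` and `Γ_K` acts continuously, `resField` has finite fibres — its kernel
    restricts to zero on the finite-index subgroup `ker κ ∩ res(Γ_F)` of `ker κ`, so it is caught by the finite
    inflation–restriction kernel `finite_ker_resOfLe` (`Theorems/AlignedTransport…FineRoadInfRes`).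
* §3 `Cutout`: for `K/ℚ` quadratic and `M` of order `p` with a `Γ_ℚ`-action inducing the (continuous) `Γ_K`-action, the field
  `F = ℚ̄^{N}`, `N = res_{K/ℚ}(ker(Γ_K → Aut M))`, is an ABELIAN number field containing (a copy of) `K`, of degree `[F:K] =
  #(Γ_K · m₀) < p` over `K`, with `res(Γ_F) = ker(Γ_K → Aut M)` (`exists_trivialising_abelian_field`).  Ingredients: `res(Γ_K)`
  has index `2` in `Γ_ℚ` (so it is normal with abelian quotient — `Subgroup.mul_mem_iff_of_index_two`), `Γ_ℚ` acts on `M` by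
  commuting scalars (§1), the infinite Galois correspondence for open subgroups (`ArtinRestriction`), and the tower mediator
  `towerGaloisRep` (`conj_absGaloisRestrict_absGaloisRestrict`).
* §4 `Assembly`: **`unrInput_of_ferreroWashington`** `: ferreroWashington1979_classicalMuVanishes →
  classicalMuVanishes_finite_unramifiedClasses → [Unr]` with `[Unr]` token-for-token the hypothesis `hUnr` of
  `InterludeWithTorsion.residualGL1FinitenessOdd_of_unr_even'`.  Proof: WLOG `Γ_K` acts continuously (else `H¹(K_∞, M) = 0`,
  `discreteH1_eq_zero_of_not_continuous` + `continuous_smul_of_continuous_smul_kerSubgroup`, W2's `…ResidualGL1Continuity`);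
  take `F` from §3; `κ_F = κ.restrict F` is cyclotomic (`isCyclotomic_restrict`) and `Γ_F` acts trivially on `M`, so
  Ferrero–Washington for the abelian field `F` and `classicalMuVanishes_finite_unramifiedClasses` give finiteness of the
  everywhere-unramified classes in `H¹(F_∞, M)`; §2 transports it down to `K_∞`.  Corollaries BY NAME:
  **`gl1InputUnramified_of_ferreroWashington`** `: FW → U → RoadBHelpers.GL1InputUnramified` (= the TYPE of the registered v10
  stub `stub_gl1InputUnramified`, `Theorems/…InterludeRoadBGL1Reduction`; so that stub is closed MODULO the two named facts, i.e.
  it joins the PUB list) and **`residualGL1FinitenessOdd_of_ferreroWashington_even`** `: FW → U → [Even] →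
  InterludeWithTorsion.ResidualGL1FinitenessOdd` ((B3) BY NAME from PUB ∧ [Even]).

LEDGER (numbers, not adjectives): farm `lean check` rc 0 · errors 0 · warnings 0 · sorries 0; 20 declarations; conditional
inputs = exactly the two `def … : Prop` named facts of `Literature/NumberTheory/IwasawaTheory` (Ferrero–Washington 1979;
Washington §13.5 Prop. 13.28), displayed as hypotheses; no new axioms, no `@[conjecture]` introduced.  Road B's (B3) thereby rests
on PUB ∧ [Even] (Greenberg LNM 1716 Lemma 5.9 over `K_∞`, W2's `hEven`); crux 5 BY NAME on PUB ∧ crux 2 ∧ XI″ ∧ [Even].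

References: B. Ferrero, L. Washington, Ann. of Math. 109 (1979) 377–395 [FerreroWashington1979]; L. Washington,
*Introduction to Cyclotomic Fields*, §13.5 (Prop. 13.28: `μ = 0` and unramified classes) [Washington1997];
R. Greenberg, V. Vatsal, Invent. Math. 142 (2000), §2 [GreenbergVatsal2000]; J.-P. Serre, *Galois Cohomology*, I §2.6, I §5
[SerreGaloisCohomology1997]; J. Neukirch, *Algebraic Number Theory*, Ch. I §9, Ch. II §9, Ch. IV §1 [NeukirchANT1999].
-/

noncomputable section

set_option linter.dupNamespace false
set_option autoImplicit false

open scoped NumberField Pointwise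
open Field IsDedekindDomain
open Literature.NumberTheory.GaloisRepresentations
open Literature.NumberTheory.EllipticCurves Literature.NumberTheory.EllipticCurves.GreenbergSelmer
open Literature.NumberTheory.EllipticCurves.GreenbergVatsal2000

universe u

namespace Summit.BirchSwinnertonDyer.BirchSwinnertonDyer.Theorems.InterludeWithTorsion.UnrTransport

/-! ## §1 Modules of prime order: group elements act by integer scalars -/

section PrimeOrder

variable {Γ : Type u} [Group Γ] {M : Type u} [AddCommGroup M] [DistribMulAction Γ M]

/-- A group of prime order is generated (over `ℤ`) by a non-zero element. [folklore] -/
theorem exists_forall_exists_zsmul_eq {p : ℕ} [Fact p.Prime] (hcard : Nat.card M = p) :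
    ∃ m₀ : M, m₀ ≠ 0 ∧ ∀ m : M, ∃ n : ℤ, n • m₀ = m := by
  haveI := isAddCyclic_of_prime_card hcard
  obtain ⟨g, hg⟩ := IsAddCyclic.exists_zsmul_surjective (G := M)
  refine ⟨g, ?_, fun m ↦ hg m⟩
  rintro rfl
  haveI : Subsingleton M := ⟨fun a b ↦ by
    obtain ⟨i, rfl⟩ := hg a
    obtain ⟨j, rfl⟩ := hg b
    simp⟩
  have h1 : Nat.card M = 1 := Nat.card_of_subsingleton (0 : M)
  rw [hcard] at h1
  exact (Fact.out : p.Prime).one_lt.ne' h1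

/-- On a module of prime order every group element acts by an integer scalar (the action is additive and `M` is
cyclic). [folklore] -/
theorem exists_int_forall_smul_eq {p : ℕ} [Fact p.Prime] (hcard : Nat.card M = p) (g : Γ) :
    ∃ k : ℤ, ∀ m : M, g • m = k • m := by
  obtain ⟨m₀, -, hgen⟩ := exists_forall_exists_zsmul_eq (M := M) hcard
  obtain ⟨k, hk⟩ := hgen (g • m₀)
  refine ⟨k, fun m ↦ ?_⟩
  obtain ⟨n, rfl⟩ := hgen m
  rw [smul_comm g n m₀, ← hk, smul_smul, smul_smul, mul_comm]

/-- An element fixing a generator fixes everything. [folklore] -/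
theorem smul_eq_self_of_smul_generator_eq {g : Γ} {m₀ : M} (hgen : ∀ m : M, ∃ n : ℤ, n • m₀ = m)
    (hg : g • m₀ = m₀) (m : M) : g • m = m := by
  obtain ⟨n, rfl⟩ := hgen m
  rw [smul_comm g n m₀, hg]

/-- Membership in the kernel of the action. [folklore] -/
theorem mem_ker_toPermHom_iff (g : Γ) :
    g ∈ (MulAction.toPermHom Γ M).ker ↔ ∀ m : M, g • m = m := by
  rw [MonoidHom.mem_ker, Equiv.ext_iff]
  rfl

end PrimeOrder

/-! ## §2 Transport of everywhere-unramified classes along a finite extension `F/K` -/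

section OverK

variable {K : Type} [Field K] [NumberField K]
variable (H : Subgroup (absoluteGaloisGroup K)) [H.Normal]
variable (M : Type) [AddCommGroup M] [DistribMulAction (absoluteGaloisGroup K) M] [TopologicalSpace M]
  [DiscreteTopology M]

variable {H M} in
/-- **A class all of whose conjugates lie in every `unramifiedKer H M v` dies on EVERY inertia group `I_𝔓 ∩ H`, `𝔓 ∣ v`**
(not only on the chosen `I_{𝔓₀}`): the Greenberg–Vatsal transitivity argument of
`GreenbergVatsal2000.resOfLe_inertia_inf_eq_zero_of_mem_unramifiedOutside`, with the set of excluded places empty.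
[cite: GreenbergVatsal2000, §2 pp. 16–17] [cite: NeukirchANT1999, Ch. I §9 Prop. (9.1)] -/
theorem resOfLe_inertia_inf_eq_zero_of_forall {c : subgroupH1 H M}
    (hc : ∀ (v : HeightOneSpectrum (𝓞 K)) (σ : absoluteGaloisGroup K), conjH1 H M σ c ∈ unramifiedKer H M v)
    {v : HeightOneSpectrum (𝓞 K)} {𝔓 : Ideal (absIntegers (𝓞 K) K)} (h𝔓 : 𝔓 ∈ v.primesAbove) :
    resOfLe M (inf_le_right : 𝔓.inertia (absoluteGaloisGroup K) ⊓ H ≤ H) c = 0 := by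
  classical
  obtain ⟨z, rfl⟩ := oneCocycleClass_surjective _ c
  -- `𝔓 = ρ₀ • 𝔓₀`
  obtain ⟨ρ₀, hρ₀⟩ := HeightOneSpectrum.exists_smul_eq_of_mem_primesAbove_holds
    (adicCompletionPrime_mem_primesAbove K v) h𝔓
  -- the GV condition for the conjugate `ρ₀⁻¹`
  have h1 := hc v ρ₀⁻¹
  rw [conjH1_oneCocycleClass_mem_unramifiedKer_iff] at h1
  obtain ⟨a, ha⟩ := h1
  rw [CocycleCriteria.resOfLe_oneCocycleClass_eq_zero_iff]
  refine ⟨ρ₀ • a, fun x => ?_⟩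
  have hxI : (x : absoluteGaloisGroup K) ∈ 𝔓.inertia (absoluteGaloisGroup K) := x.2.1
  have hxH : (x : absoluteGaloisGroup K) ∈ H := x.2.2
  -- `y = ρ₀⁻¹ x ρ₀ ∈ H ∩ I_{𝔓₀}`
  have hyI : ρ₀⁻¹ * (x : absoluteGaloisGroup K) * ρ₀ ∈ GreenbergSelmer.inertia v := by
    rw [GreenbergSelmer.inertia, ← inertia_adicCompletionPrime_eq_map_absInertia]
    refine (Ideal.conj_mem_inertia_smul_iff (adicCompletionPrime K v) ρ₀ _).mp ?_
    rw [hρ₀, show ρ₀ * (ρ₀⁻¹ * (x : absoluteGaloisGroup K) * ρ₀) * ρ₀⁻¹ = (x : absoluteGaloisGroup K) by group]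
    exact hxI
  have hyD : ρ₀⁻¹ * (x : absoluteGaloisGroup K) * ρ₀ ∈ GreenbergSelmer.decomp v :=
    GreenbergSelmer.inertia_le_decomp v hyI
  have hyH : ρ₀⁻¹ * (x : absoluteGaloisGroup K) * ρ₀ ∈ H := Subgroup.Normal.conj_mem' inferInstance _ hxH ρ₀
  let y : inertiaIn H v := ⟨⟨ρ₀⁻¹ * (x : absoluteGaloisGroup K) * ρ₀, hyD⟩, (mem_inertiaIn_iff H v _).2 ⟨hyH, hyI⟩⟩
  have key := ha y
  have e : subgroupConj H ρ₀⁻¹ (inertiaInToH H v y) = Subgroup.inclusion inf_le_right x := by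
    apply Subtype.ext
    rw [subgroupConj_apply_coe]
    change ρ₀⁻¹⁻¹ * (ρ₀⁻¹ * (x : absoluteGaloisGroup K) * ρ₀) * ρ₀⁻¹ = (x : absoluteGaloisGroup K)
    group
  rw [e] at key
  change ρ₀⁻¹ • z.1 (Subgroup.inclusion inf_le_right x) = (ρ₀⁻¹ * (x : absoluteGaloisGroup K) * ρ₀) • a - a at key
  have key' := congrArg (fun m : M => ρ₀ • m) key
  dsimp only at key'
  rw [smul_inv_smul, smul_sub, ← mul_smul,
    show ρ₀ * (ρ₀⁻¹ * (x : absoluteGaloisGroup K) * ρ₀) = (x : absoluteGaloisGroup K) * ρ₀ by group, mul_smul] at key'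
  exact key'

/-- `GreenbergSelmer.inertia v` is the inertia group of the distinguished prime `𝔓₀ = adicCompletionPrime K v`.
[cite: NeukirchANT1999, Ch. II §9 Prop. (9.6)] -/
theorem inertia_eq_inertia_adicCompletionPrime (v : HeightOneSpectrum (𝓞 K)) :
    GreenbergSelmer.inertia v = (adicCompletionPrime K v).inertia (absoluteGaloisGroup K) := by
  rw [GreenbergSelmer.inertia, ← inertia_adicCompletionPrime_eq_map_absInertia]

end OverK

section Transport

variable {K F : Type} [Field K] [Field F] [NumberField F] [Algebra K F]
variable {p : ℕ} [Fact p.Prime] (κ : ZpExtension K p)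
  (hs : Function.Surjective (κ.toContinuousMonoidHom.comp (absGaloisRestrict K F)))
variable (M : Type) [AddCommGroup M] [DistribMulAction (absoluteGaloisGroup K) M]
  [DistribMulAction (absoluteGaloisGroup F) M] [TopologicalSpace M] [DiscreteTopology M]

/-- `res` maps `ker κ_F` into `ker κ` (`κ_F = κ ∘ res`). [cite: Washington1997, §13.1] -/
theorem absGaloisRestrict_mem_kerSubgroup {σ : absoluteGaloisGroup F} (hσ : σ ∈ (κ.restrict F hs).kerSubgroup) :
    absGaloisRestrict K F σ ∈ κ.kerSubgroup := by
  rw [ZpExtension.kerSubgroup_restrict] at hσ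
  exact hσ

/-- Conversely, `res σ ∈ ker κ` implies `σ ∈ ker κ_F`. [cite: Washington1997, §13.1] -/
theorem mem_kerSubgroup_restrict_of {σ : absoluteGaloisGroup F} (hσ : absGaloisRestrict K F σ ∈ κ.kerSubgroup) :
    σ ∈ (κ.restrict F hs).kerSubgroup := by
  rw [ZpExtension.kerSubgroup_restrict]
  exact hσ

/-- `res : Gal(F̄/F_∞) → Gal(K̄/K_∞)`, the restriction `Γ_F → Γ_K` on the kernels of `κ_F = κ ∘ res` and `κ`.
[cite: Washington1997, §13.1] [cite: SerreGaloisCohomology1997, I §2.4] -/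
def kerRestrict : (κ.restrict F hs).kerSubgroup →ₜ* κ.kerSubgroup where
  toFun x := ⟨absGaloisRestrict K F x, absGaloisRestrict_mem_kerSubgroup κ hs x.2⟩
  map_one' := Subtype.ext (map_one (absGaloisRestrict K F))
  map_mul' x y := Subtype.ext (map_mul (absGaloisRestrict K F) (x : absoluteGaloisGroup F) (y : absoluteGaloisGroup F))
  continuous_toFun :=
    ((absGaloisRestrict K F).continuous.comp continuous_subtype_val).subtype_mk _

@[simp]
theorem kerRestrict_apply_coe (x : (κ.restrict F hs).kerSubgroup) :
    ((kerRestrict κ hs x : κ.kerSubgroup) : absoluteGaloisGroup K) = absGaloisRestrict K F x := rfl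

variable (hMF : ∀ (σ : absoluteGaloisGroup F) (m : M), σ • m = (absGaloisRestrict K F σ) • m)
include hMF

/-- **The pull-back `H¹(K_∞, M) → H¹(F_∞, M)`** along `res : Gal(F̄/F_∞) → Gal(K̄/K_∞)` (`F_∞ = F K_∞`), for a
`Γ_K`-module `M` on which `Γ_F` acts through `res`. [cite: SerreGaloisCohomology1997, I §2.4 (compatible pairs)] -/
def resField : subgroupH1 κ.kerSubgroup M →+ subgroupH1 (κ.restrict F hs).kerSubgroup M :=
  resH1Hom (kerRestrict κ hs) (AddMonoidHom.id M) (fun x m ↦ by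
    rw [AddMonoidHom.id_apply, AddMonoidHom.id_apply, Subgroup.smul_def, Subgroup.smul_def, kerRestrict_apply_coe, hMF])

/-- `resField` on an explicit class: the class of the pulled-back cocycle `x ↦ z (res x)`.
[cite: SerreGaloisCohomology1997, I §2.4] -/
theorem resField_oneCocycleClass (z : contOneCocycles (discreteTopRep κ.kerSubgroup M)) :
    resField κ hs M hMF (oneCocycleClass _ z) =
      oneCocycleClass (discreteTopRep (κ.restrict F hs).kerSubgroup M)
        (contOneCocycles.pullback (kerRestrict κ hs) (resHomOfEquivariant (kerRestrict κ hs) (AddMonoidHom.id M)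
          (fun x m ↦ by
            rw [AddMonoidHom.id_apply, AddMonoidHom.id_apply, Subgroup.smul_def, Subgroup.smul_def,
              kerRestrict_apply_coe, hMF])) z) :=
  resH1Hom_oneCocycleClass _ _ _ z

variable [NumberField K]

/-- **Everywhere-unramified classes pull back to everywhere-unramified classes.**  For `w` a place of `F` over `v`,
`σ' ∈ Γ_F` and `y ∈ I_w ∩ ker κ_F`: `res(σ'⁻¹ y σ') ∈ I_𝔓 ∩ ker κ` for the prime `𝔓 = res(σ')⁻¹ • (𝔓₀(w) ∩ K̄)` above `v`
(`absGaloisRestrict_mem_inertia_comap`), where the class dies by `resOfLe_inertia_inf_eq_zero_of_forall`.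
[cite: GreenbergVatsal2000, §2 pp. 16–17] [cite: NeukirchANT1999, Ch. I §9, Ch. II §9 Prop. (9.6)] -/
theorem resField_mem_unramifiedKer (c : subgroupH1 κ.kerSubgroup M)
    (hc : ∀ (v : HeightOneSpectrum (𝓞 K)) (σ : absoluteGaloisGroup K),
      conjH1 κ.kerSubgroup M σ c ∈ unramifiedKer κ.kerSubgroup M v)
    (w : HeightOneSpectrum (𝓞 F)) (σ' : absoluteGaloisGroup F) :
    conjH1 (κ.restrict F hs).kerSubgroup M σ' (resField κ hs M hMF c) ∈
      unramifiedKer (κ.restrict F hs).kerSubgroup M w := by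
  classical
  obtain ⟨z, rfl⟩ := oneCocycleClass_surjective _ c
  set H := κ.kerSubgroup with hHdef
  set H' := (κ.restrict F hs).kerSubgroup with hH'def
  set r := absGaloisRestrict K F with hrdef
  -- the place below `w`, the distinguished prime of `F̄` at `w`, its contraction to `K̄`, and its conjugate
  set v : HeightOneSpectrum (𝓞 K) := w.under (𝓞 K) with hvdef
  have hvw : w.asIdeal.under (𝓞 K) = v.asIdeal := rfl
  set 𝔔₀ := adicCompletionPrime F w with h𝔔₀
  have h𝔓₁ : 𝔔₀.comap (absIntegersMap K F) ∈ v.primesAbove :=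
    comap_absIntegersMap_mem_primesAbove hvw (adicCompletionPrime_mem_primesAbove F w)
  set ρ : absoluteGaloisGroup K := r σ' with hρdef
  have h𝔓 : ρ⁻¹ • 𝔔₀.comap (absIntegersMap K F) ∈ v.primesAbove := smul_mem_primesAbove h𝔓₁ ρ⁻¹
  -- the class dies on `I_𝔓 ∩ H`
  have hdies := resOfLe_inertia_inf_eq_zero_of_forall (H := H) (M := M) hc h𝔓
  rw [CocycleCriteria.resOfLe_oneCocycleClass_eq_zero_iff] at hdies
  obtain ⟨a, ha⟩ := hdies
  -- unfold the pulled-back, conjugated class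
  rw [resField_oneCocycleClass, conjH1_oneCocycleClass_mem_unramifiedKer_iff]
  refine ⟨σ' • a, fun y ↦ ?_⟩
  have hy := (mem_inertiaIn_iff H' w _).1 y.2
  have hyH' : ((y : decomp (K := F) w) : absoluteGaloisGroup F) ∈ H' := hy.1
  have hyI : ((y : decomp (K := F) w) : absoluteGaloisGroup F) ∈ 𝔔₀.inertia (absoluteGaloisGroup F) := by
    rw [h𝔔₀, ← inertia_eq_inertia_adicCompletionPrime]
    exact hy.2
  -- `x₀ = ρ⁻¹ · res(y) · ρ ∈ I_𝔓 ∩ H`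
  have hry_I : r y ∈ (𝔔₀.comap (absIntegersMap K F)).inertia (absoluteGaloisGroup K) :=
    absGaloisRestrict_mem_inertia_comap K F hyI
  have hry_H : r y ∈ H := absGaloisRestrict_mem_kerSubgroup κ hs hyH'
  have hx₀I : ρ⁻¹ * r y * ρ ∈ (ρ⁻¹ • 𝔔₀.comap (absIntegersMap K F)).inertia (absoluteGaloisGroup K) := by
    have := (Ideal.conj_mem_inertia_smul_iff (𝔔₀.comap (absIntegersMap K F)) ρ⁻¹ (r y)).mpr hry_I
    simpa only [inv_inv] using this
  have hx₀H : ρ⁻¹ * r y * ρ ∈ H := Subgroup.Normal.conj_mem' inferInstance _ hry_H ρ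
  have key := ha ⟨ρ⁻¹ * r y * ρ, hx₀I, hx₀H⟩
  -- the argument of the pulled-back cocycle is `x₀`
  have e : kerRestrict κ hs (subgroupConj H' σ' (inertiaInToH H' w y)) =
      Subgroup.inclusion inf_le_right ⟨ρ⁻¹ * r y * ρ, hx₀I, hx₀H⟩ := by
    apply Subtype.ext
    rw [kerRestrict_apply_coe, subgroupConj_apply_coe]
    change r (σ'⁻¹ * ((y : decomp (K := F) w) : absoluteGaloisGroup F) * σ') = ρ⁻¹ * r y * ρ
    rw [map_mul, map_mul, map_inv]
  rw [pullback_resHomOfEquivariant_apply, AddMonoidHom.id_apply, e, key, hMF σ', smul_sub, ← mul_smul,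
    show ρ * (ρ⁻¹ * r y * ρ) = r y * ρ by group, mul_smul, hMF, hMF σ' a]

/-- **The pull-back has finite fibres** when `res(Γ_F)` is normal in `Γ_K` and `Γ_K` acts continuously on the finite
module `M`: a class in its kernel restricts to zero on `ker κ ∩ res(Γ_F)`, a subgroup of finite index of `ker κ`
normalised by it, and the kernel of that restriction is finite by inflation–restriction (`finite_ker_resOfLe`).
[cite: SerreGaloisCohomology1997, I §2.6 (b)] -/
theorem finite_preimage_resField [Finite M]
    (hnorm : ((absGaloisRestrict K F).range : Subgroup (absoluteGaloisGroup K)).Normal)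
    (hcont : ∀ m : M, Continuous fun g : absoluteGaloisGroup K ↦ g • m)
    {T : Set (subgroupH1 (κ.restrict F hs).kerSubgroup M)} (hT : T.Finite) :
    {c : subgroupH1 κ.kerSubgroup M | resField κ hs M hMF c ∈ T}.Finite := by
  classical
  set H := κ.kerSubgroup with hHdef
  set R : Subgroup (absoluteGaloisGroup K) := (absGaloisRestrict K F).range with hRdef
  have hle : H ⊓ R ≤ H := inf_le_left
  -- (1) the kernel of `resField` restricts to zero on `H ⊓ R`
  have hker : ∀ c, resField κ hs M hMF c = 0 → resOfLe M hle c = 0 := by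
    intro c hc
    obtain ⟨z, rfl⟩ := oneCocycleClass_surjective _ c
    obtain ⟨n, hn⟩ := (CocycleCriteria.resH1Hom_oneCocycleClass_eq_zero_iff _ _ _ z).mp hc
    rw [CocycleCriteria.resOfLe_oneCocycleClass_eq_zero_iff]
    refine ⟨n, fun x ↦ ?_⟩
    obtain ⟨y, hy⟩ : (x : absoluteGaloisGroup K) ∈ R := x.2.2
    have hy' : absGaloisRestrict K F y = (x : absoluteGaloisGroup K) := hy
    have hyH : y ∈ (κ.restrict F hs).kerSubgroup :=
      mem_kerSubgroup_restrict_of κ hs (by rw [hy']; exact x.2.1)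
    have key := hn ⟨y, hyH⟩
    have e : kerRestrict κ hs ⟨y, hyH⟩ = Subgroup.inclusion hle x := Subtype.ext hy'
    rw [e, AddMonoidHom.id_apply, Subgroup.smul_def, hMF] at key
    rw [key]
    change (absGaloisRestrict K F y) • n - n = _
    rw [hy']
  -- (2) that restriction kernel is finite (inflation–restriction)
  have hRidx : R.index = Module.finrank K F := index_range_absGaloisRestrict_eq_finrank K F
  haveI : FiniteDimensional K F := Module.Finite.of_restrictScalars_finite ℚ K F
  have hRne : R.index ≠ 0 := by rw [hRidx]; exact Module.finrank_pos.ne'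
  have hind : ((H ⊓ R).subgroupOf H).FiniteIndex := by
    refine ⟨fun h0 ↦ hRne ?_⟩
    have h1 : (H ⊓ R).relIndex H = 0 := h0
    rw [Subgroup.inf_relIndex_left] at h1
    exact Subgroup.index_eq_zero_of_relIndex_eq_zero h1
  have hK₀ : {c : subgroupH1 H M | resOfLe M hle c = 0}.Finite :=
    AlignedTransportAtTwoFineRoad.InfRes.finite_ker_resOfLe hle
      (fun g hg h hh ↦ ⟨H.mul_mem (H.mul_mem (H.inv_mem hg) hh.1) hg, hnorm.conj_mem' _ hh.2 g⟩)
      hind hcont inferInstance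
  -- (3) fibres are translates of the kernel
  change ((resField κ hs M hMF) ⁻¹' T).Finite
  refine hT.preimage' fun b _ ↦ ?_
  by_cases hb : ∃ c₀, resField κ hs M hMF c₀ = b
  · obtain ⟨c₀, hc₀⟩ := hb
    refine (hK₀.image fun k ↦ c₀ + k).subset fun c hc ↦ ?_
    refine ⟨c - c₀, hker _ ?_, by abel⟩
    rw [map_sub, hc₀, show resField κ hs M hMF c = b from hc, sub_self]
  · have : (resField κ hs M hMF) ⁻¹' {b} = ∅ :=
      Set.eq_empty_iff_forall_notMem.mpr fun c hc ↦ hb ⟨c, hc⟩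
    rw [this]
    exact Set.finite_empty

end Transport

/-! ## §3 The trivialising abelian field `F = ℚ̄^{res(ker(Γ_K → Aut M))}` -/

section AbelianFixedField

/-- For a field `k` of characteristic `0` and an open normal subgroup `N ⊴ Γ_k` containing all commutators, the fixed
field `k̄^N` is an abelian (finite Galois) extension of `k`: `Gal(k̄^N/k)` is a quotient of `Γ_k` (`resGal`) by
`Gal(k̄/k̄^N) = N` (`ker_resGal`, `fixingSubgroup_fixedField_of_isOpen`).  Stated for a general `k` so that every
instance is Mathlib's canonical one. [cite: NeukirchANT1999, Ch. IV §1] [cite: MilneFT2022, Ch. 7 Thm. 7.12] -/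
theorem isAbelianGalois_fixedField_of_commutator_mem {k : Type} [Field k] [CharZero k]
    (N : Subgroup (absoluteGaloisGroup k)) (hN : N.Normal) (hNopen : IsOpen (N : Set (absoluteGaloisGroup k)))
    (hcomm : ∀ τ₁ τ₂ : absoluteGaloisGroup k, τ₁ * τ₂ * τ₁⁻¹ * τ₂⁻¹ ∈ N) :
    IsAbelianGalois k (IntermediateField.fixedField N) := by
  have hfix : (IntermediateField.fixedField N).fixingSubgroup = N := fixingSubgroup_fixedField_of_isOpen N hNopen
  haveI : IsGalois k (IntermediateField.fixedField N) :=
    (InfiniteGalois.normal_iff_isGalois _).mp (by rw [hfix]; exact hN)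
  have hab : ∀ φ₁ φ₂ : (IntermediateField.fixedField N) ≃ₐ[k] (IntermediateField.fixedField N),
      φ₁ * φ₂ = φ₂ * φ₁ := fun φ₁ φ₂ ↦ by
    obtain ⟨τ₁, rfl⟩ := resGal_surjective (IntermediateField.fixedField N) φ₁
    obtain ⟨τ₂, rfl⟩ := resGal_surjective (IntermediateField.fixedField N) φ₂
    rw [← commutatorElement_eq_one_iff_mul_comm, commutatorElement_def, ← map_inv, ← map_inv, ← map_mul,
      ← map_mul, ← map_mul, ← MonoidHom.mem_ker, ker_resGal, LocalWeilDatum.mem_galFixing_iff]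
    intro x hx
    have hmem : τ₁ * τ₂ * τ₁⁻¹ * τ₂⁻¹ ∈ (IntermediateField.fixedField N).fixingSubgroup := by
      rw [hfix]; exact hcomm τ₁ τ₂
    exact (mem_fixingSubgroup_iff_forall_smul _ _).1 hmem ⟨x, hx⟩
  haveI : IsMulCommutative ((IntermediateField.fixedField N) ≃ₐ[k] (IntermediateField.fixedField N)) := ⟨⟨hab⟩⟩
  exact IsAbelianGalois.mk

end AbelianFixedField

section Cutout

variable (K : Type) [Field K] [NumberField K] {p : ℕ} [Fact p.Prime]
variable (M : Type) [AddCommGroup M] [DistribMulAction (absoluteGaloisGroup ℚ) M]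
  [DistribMulAction (absoluteGaloisGroup K) M] [TopologicalSpace M] [DiscreteTopology M]

/-- **The trivialising field.**  Let `K/ℚ` be quadratic, `M` of prime order `p` with a `Γ_ℚ`-action inducing the
`Γ_K`-action along `res_{K/ℚ}`, the latter continuous.  Then there is an ABELIAN number field `F ⊇ K` (namely
`F = ℚ̄^N`, `N = res_{K/ℚ}(S)`, `S = ker(Γ_K → Aut M)`) with `p ∤ [F:K]` and `res_{F/K}(Γ_F) = S`.  Steps: `res(Γ_K)` has
index `2` in `Γ_ℚ`, hence is normal with commutators inside it (`Subgroup.mul_mem_iff_of_index_two`); `Γ_ℚ` acts on `M`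
through commuting integer scalars (§1), so `N ⊴ Γ_ℚ` and `Γ_ℚ/N` is abelian; `N` is closed of index `2·#(Γ_K m₀) <
2p`, hence open; `F = ℚ̄^N` is finite Galois over `ℚ` with `Gal(F/ℚ)` a quotient of `Γ_ℚ/N` (`resGal`, `ker_resGal`);
`K ↪ F` because `N ≤ res(Γ_K) = Gal(ℚ̄/K₀)`, `K₀ ≅ K` (`exists_range_absGaloisRestrict_eq_fixingSubgroup`); and
`res_{K/ℚ} ∘ res_{F/K}` is `res_{F/ℚ}` up to the inner automorphism `towerGaloisRep`
(`conj_absGaloisRestrict_absGaloisRestrict`), whose range is `N` (`exists_mem_range_absGaloisRestrict_fixedField_iff`).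
[cite: NeukirchANT1999, Ch. IV §1] [cite: MilneFT2022, Ch. 7] [cite: Washington1997, §13.5] -/
theorem exists_trivialising_abelian_field (h2 : Module.finrank ℚ K = 2) (hcard : Nat.card M = p)
    (hM : ∀ (σ : absoluteGaloisGroup K) (m : M), σ • m = (absGaloisRestrict ℚ K σ) • m)
    (hcont : ∀ m : M, Continuous fun g : absoluteGaloisGroup K ↦ g • m) :
    ∃ (F : Type) (_ : Field F) (_ : NumberField F) (_ : Algebra K F),
      IsAbelianGalois ℚ F ∧ ¬ p ∣ Module.finrank K F ∧
        ((absGaloisRestrict K F).range : Subgroup (absoluteGaloisGroup K)) =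
          (MulAction.toPermHom (absoluteGaloisGroup K) M).ker := by
  classical
  have hp : p.Prime := Fact.out
  haveI : Finite M := Nat.finite_of_card_ne_zero (hcard ▸ hp.ne_zero)
  -- the kernel `S` of the action of `Γ_K`
  set S : Subgroup (absoluteGaloisGroup K) := (MulAction.toPermHom (absoluteGaloisGroup K) M).ker with hSdef
  have hmemS : ∀ g, g ∈ S ↔ ∀ m : M, g • m = m := fun g ↦ mem_ker_toPermHom_iff g
  -- `res : Γ_K → Γ_ℚ`, injective with range `R` of index `2`
  set r := absGaloisRestrict ℚ K with hrdef
  have hrinj : Function.Injective r := absGaloisRestrict_injective ℚ K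
  set R : Subgroup (absoluteGaloisGroup ℚ) := r.range with hRdef
  have hR2 : R.index = 2 := by
    rw [hRdef, hrdef, (Literature.NumberTheory.Automorphic.isOpen_range_absGaloisRestrict_and_index ℚ K).2, h2]
  haveI hRnormal : R.Normal := Subgroup.normal_of_index_eq_two hR2
  -- (A) `S` is the stabiliser of a generator: open, closed, of index `#(orbit) < p`
  obtain ⟨m₀, hm₀, hgen⟩ := exists_forall_exists_zsmul_eq (M := M) hcard
  have hSstab : S = MulAction.stabilizer (absoluteGaloisGroup K) m₀ := by
    ext g
    rw [hmemS, MulAction.mem_stabilizer_iff]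
    exact ⟨fun h ↦ h m₀, fun h m ↦ smul_eq_self_of_smul_generator_eq hgen h m⟩
  have hSopen : IsOpen (S : Set (absoluteGaloisGroup K)) := by
    rw [hSstab]
    exact (isOpen_discrete ({m₀} : Set M)).preimage (hcont m₀)
  have hSclosed : IsClosed (S : Set (absoluteGaloisGroup K)) := Subgroup.isClosed_of_isOpen S hSopen
  have hSidx : S.index = (MulAction.orbit (absoluteGaloisGroup K) m₀).ncard := by
    rw [hSstab, MulAction.index_stabilizer]
  have horb_lt : (MulAction.orbit (absoluteGaloisGroup K) m₀).ncard < p := by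
    have hsub : MulAction.orbit (absoluteGaloisGroup K) m₀ ⊆ ({0} : Set M)ᶜ := by
      rintro _ ⟨g, rfl⟩ h0
      apply hm₀
      have h0' : g • m₀ = 0 := h0
      have := congrArg (fun m : M ↦ g⁻¹ • m) h0'
      simpa using this
    have hc := Set.ncard_add_ncard_compl ({0} : Set M)
    rw [Set.ncard_singleton, hcard] at hc
    have hle := Set.ncard_le_ncard hsub (Set.toFinite _)
    omega
  have horb_pos : 0 < (MulAction.orbit (absoluteGaloisGroup K) m₀).ncard :=
    (Set.ncard_pos (Set.toFinite _)).mpr ⟨m₀, MulAction.mem_orbit_self m₀⟩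
  have hSpos : 0 < S.index := by rw [hSidx]; exact horb_pos
  have hndvd : ¬ p ∣ S.index := fun h ↦ absurd horb_lt (not_lt.mpr (hSidx ▸ Nat.le_of_dvd hSpos h))
  haveI hSfi : S.FiniteIndex := ⟨hSpos.ne'⟩
  -- (B) `N = res(S) ⊴ Γ_ℚ` with abelian quotient
  set N : Subgroup (absoluteGaloisGroup ℚ) := S.map r.toMonoidHom with hNdef
  have hmemN : ∀ x, x ∈ N ↔ ∃ s ∈ S, r s = x := fun x ↦ by
    rw [hNdef, Subgroup.mem_map]
    rfl
  have hNR : N ≤ R := fun x hx ↦ by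
    obtain ⟨s, -, rfl⟩ := (hmemN x).1 hx
    exact ⟨s, rfl⟩
  have hscal : ∀ τ : absoluteGaloisGroup ℚ, ∃ k : ℤ, ∀ m : M, τ • m = k • m := exists_int_forall_smul_eq hcard
  have hract : ∀ (s : absoluteGaloisGroup K) (m : M), r s • m = s • m := fun s m ↦ (hM s m).symm
  have hNnormal : N.Normal := ⟨fun n hn τ ↦ by
    obtain ⟨s, hs, rfl⟩ := (hmemN n).1 hn
    obtain ⟨s', hs'⟩ : τ * r s * τ⁻¹ ∈ R := hRnormal.conj_mem _ ⟨s, rfl⟩ τ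
    have hs'' : r s' = τ * r s * τ⁻¹ := hs'
    refine (hmemN _).2 ⟨s', (hmemS s').2 fun m ↦ ?_, hs''⟩
    rw [← hract s' m, hs'', mul_smul, mul_smul, hract, (hmemS s).1 hs, smul_inv_smul]⟩
  have hcommR : ∀ τ₁ τ₂ : absoluteGaloisGroup ℚ, τ₁ * τ₂ * τ₁⁻¹ * τ₂⁻¹ ∈ R := fun τ₁ τ₂ ↦ by
    simp only [Subgroup.mul_mem_iff_of_index_two hR2, inv_mem_iff]
    tauto
  have hcommN : ∀ τ₁ τ₂ : absoluteGaloisGroup ℚ, τ₁ * τ₂ * τ₁⁻¹ * τ₂⁻¹ ∈ N := fun τ₁ τ₂ ↦ by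
    obtain ⟨s, hs⟩ := hcommR τ₁ τ₂
    have hs' : r s = τ₁ * τ₂ * τ₁⁻¹ * τ₂⁻¹ := hs
    refine (hmemN _).2 ⟨s, (hmemS s).2 fun m ↦ ?_, hs'⟩
    obtain ⟨k₁, hk₁⟩ := hscal τ₁
    obtain ⟨k₂, hk₂⟩ := hscal τ₂
    have hc : ∀ x : M, (τ₁ * τ₂) • x = (τ₂ * τ₁) • x := fun x ↦ by
      rw [mul_smul, mul_smul, hk₂ x, hk₁ (k₂ • x), hk₁ x, hk₂ (k₁ • x)]
      exact zsmul_comm x k₂ k₁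
    rw [← hract s m, hs', show τ₁ * τ₂ * τ₁⁻¹ * τ₂⁻¹ = (τ₁ * τ₂) * (τ₂ * τ₁)⁻¹ by group, mul_smul, hc,
      smul_inv_smul]
  -- `N` is closed of finite index, hence open
  have hNclosed : IsClosed (N : Set (absoluteGaloisGroup ℚ)) := by
    have : (N : Set (absoluteGaloisGroup ℚ)) = r '' (S : Set (absoluteGaloisGroup K)) := by
      rw [hNdef, Subgroup.coe_map]
      rfl
    rw [this]
    exact (hSclosed.isCompact.image r.continuous).isClosed
  have hNidx : N.index = S.index * 2 := by
    rw [hNdef, S.index_map_of_injective (f := r.toMonoidHom) (fun a b h ↦ hrinj h), ← hR2]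
  haveI : N.FiniteIndex := ⟨by rw [hNidx]; exact Nat.mul_ne_zero hSpos.ne' two_ne_zero⟩
  have hNopen : IsOpen (N : Set (absoluteGaloisGroup ℚ)) := Subgroup.isOpen_of_isClosed_of_finiteIndex N hNclosed
  -- (C) the field `F = ℚ̄^N`: a number field, Galois and abelian over `ℚ`
  set F' : IntermediateField ℚ (AlgebraicClosure ℚ) := IntermediateField.fixedField N with hF'def
  haveI hF'fd : FiniteDimensional ℚ F' := finiteDimensional_fixedField_of_isOpen N hNopen
  have hF'rank : Module.finrank ℚ F' = N.index := finrank_fixedField_of_isOpen N hNopen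
  have hF'fix : F'.fixingSubgroup = N := fixingSubgroup_fixedField_of_isOpen N hNopen
  haveI hF'nf : NumberField F' := NumberField.mk
  have hAb := isAbelianGalois_fixedField_of_commutator_mem N hNnormal hNopen hcommN
  -- (D) `K ↪ F`: `N ≤ res(Γ_K) = Gal(ℚ̄/K₀)` with `K₀ ≅ K`
  obtain ⟨K₀, ⟨e⟩, hK₀⟩ := Literature.NumberTheory.Automorphic.exists_range_absGaloisRestrict_eq_fixingSubgroup ℚ K
  have hle : K₀ ≤ F' := (IntermediateField.le_iff_le N K₀).mpr (hK₀ ▸ hNR)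
  let f : K →ₐ[ℚ] F' := (IntermediateField.inclusion hle).comp e.toAlgHom
  letI hAlg : Algebra K F' := f.toRingHom.toAlgebra
  haveI : IsScalarTower ℚ K F' := IsScalarTower.of_algebraMap_eq fun q ↦ (f.commutes q).symm
  have hrankKF : Module.finrank K F' = S.index := by
    have h := Module.finrank_mul_finrank ℚ K F'
    rw [h2, hF'rank, hNidx] at h
    omega
  -- (E) `res_{F/K}(Γ_F) = S`
  set r' := absGaloisRestrict K F' with hr'def
  obtain ⟨g, hg⟩ := exists_mem_range_absGaloisRestrict_fixedField_iff N hNopen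
  have hrangeQ : ∀ γ, γ ∈ (absGaloisRestrict ℚ F').range ↔ γ ∈ N := fun γ ↦ by
    refine (hg γ).trans ⟨fun h ↦ ?_, fun h ↦ hNnormal.conj_mem' _ h g⟩
    have := hNnormal.conj_mem _ h g
    rwa [show g * (g⁻¹ * γ * g) * g⁻¹ = γ by group] at this
  set t := Literature.NumberTheory.ComplexMultiplication.towerGaloisRep K F' with htdef
  have hconj : ∀ γ' : absoluteGaloisGroup F', r (r' γ') = t⁻¹ * absGaloisRestrict ℚ F' γ' * t := fun γ' ↦ by
    have h : t * r (r' γ') * t⁻¹ = absGaloisRestrict ℚ F' γ' :=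
      Literature.NumberTheory.ComplexMultiplication.conj_absGaloisRestrict_absGaloisRestrict K F' γ'
    rw [← h]
    group
  have hrange : (r'.range : Subgroup (absoluteGaloisGroup K)) = S := by
    ext s
    constructor
    · rintro ⟨γ', rfl⟩
      have h1 : r (r' γ') ∈ N := by
        rw [hconj]
        exact hNnormal.conj_mem' _ ((hrangeQ _).1 ⟨γ', rfl⟩) t
      obtain ⟨s', hs', hrs'⟩ := (hmemN _).1 h1
      change r' γ' ∈ S
      rw [← hrinj hrs']
      exact hs'
    · intro hs
      have h1 : t * r s * t⁻¹ ∈ (absGaloisRestrict ℚ F').range :=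
        (hrangeQ _).2 (hNnormal.conj_mem _ ((hmemN _).2 ⟨s, hs, rfl⟩) t)
      obtain ⟨γ', hγ'⟩ := h1
      have hγ'' : absGaloisRestrict ℚ F' γ' = t * r s * t⁻¹ := hγ'
      refine ⟨γ', hrinj ?_⟩
      change r (r' γ') = r s
      rw [hconj, hγ'']
      group
  refine ⟨F', inferInstance, inferInstance, hAlg, hAb, ?_, hrange⟩
  rw [hrankKF]
  exact hndvd

end Cutout

/-! ## §4 Assembly: `[Unr]` from Ferrero–Washington -/

section Assembly

open Literature.NumberTheory.IwasawaTheory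

/-- **[Unr] in the continuous case.**  For `K/ℚ` quadratic, `p` odd, `κ` the cyclotomic `ℤ_p`-extension and `M` of
order `p` carrying a `Γ_ℚ`-action that induces a CONTINUOUS `Γ_K`-action: the everywhere-unramified classes of
`H¹(K_∞, M)` (all conjugates in every Greenberg–Vatsal `unramifiedKer`) form a finite set — GRANTED the two printed
theorems `ferreroWashington1979_classicalMuVanishes` and `classicalMuVanishes_finite_unramifiedClasses`.  Proof: over
the abelian trivialising field `F` of §3, `κ_F = κ ∘ res` is the cyclotomic `ℤ_p`-extension (`isCyclotomic_restrict`,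
`p ∤ [F:K]`), `Γ_F` acts trivially, so the two facts give finiteness upstairs; §2 brings it down.
[cite: FerreroWashington1979, Theorem] [cite: Washington1997, §13.5 Prop. 13.28] [cite: GreenbergVatsal2000, §2] -/
theorem finite_everywhereUnramified_of_continuous
    (hFW : ferreroWashington1979_classicalMuVanishes) (hU : classicalMuVanishes_finite_unramifiedClasses)
    (K : Type) [Field K] [NumberField K] (h2 : Module.finrank ℚ K = 2)
    (p : ℕ) [Fact p.Prime] (hp2 : p ≠ 2) (κ : ZpExtension K p) (hκ : κ.IsCyclotomic)
    (M : Type) [AddCommGroup M] [DistribMulAction (absoluteGaloisGroup ℚ) M]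
    [DistribMulAction (absoluteGaloisGroup K) M] [TopologicalSpace M] [DiscreteTopology M]
    (hcard : Nat.card M = p)
    (hM : ∀ (σ : absoluteGaloisGroup K) (m : M), σ • m = (absGaloisRestrict ℚ K σ) • m)
    (hcont : ∀ m : M, Continuous fun g : absoluteGaloisGroup K ↦ g • m) :
    {c : subgroupH1 κ.kerSubgroup M | ∀ (v : HeightOneSpectrum (𝓞 K)) (σ : absoluteGaloisGroup K),
      conjH1 κ.kerSubgroup M σ c ∈ GreenbergVatsal2000.unramifiedKer κ.kerSubgroup M v}.Finite := by
  classical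
  have hp : p.Prime := Fact.out
  haveI : Finite M := Nat.finite_of_card_ne_zero (hcard ▸ hp.ne_zero)
  obtain ⟨F, _instF, _instNF, _instAlg, hAb, hndvd, hrange⟩ :=
    exists_trivialising_abelian_field K M h2 hcard hM hcont
  haveI := hAb
  -- `Γ_F` acts on `M` through `res : Γ_F → Γ_K`, trivially
  letI : DistribMulAction (absoluteGaloisGroup F) M :=
    DistribMulAction.compHom M (absGaloisRestrict K F).toMonoidHom
  have hMF : ∀ (σ : absoluteGaloisGroup F) (m : M), σ • m = (absGaloisRestrict K F σ) • m := fun _ _ ↦ rfl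
  have htriv : ∀ (σ : absoluteGaloisGroup F) (m : M), σ • m = m := fun σ m ↦ by
    have hσ : absGaloisRestrict K F σ ∈ (MulAction.toPermHom (absoluteGaloisGroup K) M).ker := by
      rw [← hrange]
      exact ⟨σ, rfl⟩
    rw [hMF]
    exact (mem_ker_toPermHom_iff _).1 hσ m
  -- `κ_F = κ ∘ res` is the cyclotomic `ℤ_p`-extension of `F`
  have hs := ZpExtension.surjective_comp_absGaloisRestrict_of_not_dvd_finrank κ F hndvd
  have hκ' : (κ.restrict F hs).IsCyclotomic := ZpExtension.isCyclotomic_restrict κ hκ F hs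
  -- Ferrero–Washington upstairs
  have hT := hU F p (κ.restrict F hs) (Or.inl (hp.odd_of_ne_two hp2)) (hFW F p (κ.restrict F hs) hκ') M
    ⟨1, by rw [pow_one, hcard]⟩ htriv
  -- transport down
  have hnormal : ((absGaloisRestrict K F).range : Subgroup (absoluteGaloisGroup K)).Normal := by
    rw [hrange]
    infer_instance
  exact (finite_preimage_resField κ hs M hMF hnormal hcont hT).subset fun c hc w σ' ↦
    resField_mem_unramifiedKer κ hs M hMF c hc w σ'

/-- **[Unr] from Ferrero–Washington.**  The hypothesis `hUnr` of
`InterludeWithTorsion.residualGL1FinitenessOdd_of_unr_even'` (`Theorems/…InterludeResidualGL1Tame`), token for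
token, follows from the two printed theorems of classical Iwasawa theory filed as named facts in
`Literature/NumberTheory/IwasawaTheory`: Ferrero–Washington `μ = 0` for abelian fields and cyclotomic `ℤ_p`-extensions
(`ferreroWashington1979_classicalMuVanishes`) and "`μ = 0` ⇒ the everywhere-unramified classes of `H¹(K_∞, M)` are
finite for a trivial `p`-primary `M`" (`classicalMuVanishes_finite_unramifiedClasses`).  The character is GENERAL: the
abelian field is `F = K·ℚ(η)` of §3.  If `Γ_K` does not act continuously, `H¹(K_∞, M) = 0`
(`discreteH1_eq_zero_of_not_continuous`, `continuous_smul_of_continuous_smul_kerSubgroup`).  CONDITIONAL on the two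
named facts (hypotheses); nothing else. [cite: FerreroWashington1979, Theorem] [cite: Washington1997, §7.5 Thm. 7.15,
§13.5 Prop. 13.28] [cite: Greenberg1999, §5 Lemma 5.9 (context)] -/
theorem unrInput_of_ferreroWashington
    (hFW : ferreroWashington1979_classicalMuVanishes) (hU : classicalMuVanishes_finite_unramifiedClasses) :
    ∀ (K : Type) [Field K] [NumberField K], IsImaginaryQuadratic K →
      ∀ (p : ℕ) [Fact p.Prime], p ≠ 2 →
      ∀ (κ : ZpExtension K p), κ.IsCyclotomic →
      ∀ (M : Type) [AddCommGroup M] [DistribMulAction (absoluteGaloisGroup ℚ) M]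
        [DistribMulAction (absoluteGaloisGroup K) M] [TopologicalSpace M] [DiscreteTopology M],
        Nat.card M = p →
        (∀ (σ : absoluteGaloisGroup K) (m : M), σ • m = (absGaloisRestrict ℚ K σ) • m) →
        {c : subgroupH1 κ.kerSubgroup M | ∀ (v : HeightOneSpectrum (𝓞 K)) (σ : absoluteGaloisGroup K),
          conjH1 κ.kerSubgroup M σ c ∈ GreenbergVatsal2000.unramifiedKer κ.kerSubgroup M v}.Finite := by
  intro K _ _ hK p _ hp2 κ hκ M _ _ _ _ _ hcard hM
  classical
  have hp : p.Prime := Fact.out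
  haveI : Finite M := Nat.finite_of_card_ne_zero (hcard ▸ hp.ne_zero)
  by_cases hcont : ∀ m : M, Continuous fun g : absoluteGaloisGroup K ↦ g • m
  · exact finite_everywhereUnramified_of_continuous hFW hU K hK.1 p hp2 κ hκ M hcard hM hcont
  · have hH : ¬ ∀ m : M, Continuous fun g : κ.kerSubgroup ↦ g • m :=
      fun h ↦ hcont fun m ↦ continuous_smul_of_continuous_smul_kerSubgroup κ h m
    have hzero : ∀ c : subgroupH1 κ.kerSubgroup M, c = 0 := fun c ↦
      discreteH1_eq_zero_of_not_continuous (G := κ.kerSubgroup) (M := M) (hcard.symm ▸ hp) hH c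
    exact (Set.finite_singleton (0 : subgroupH1 κ.kerSubgroup M)).subset fun c _ ↦ hzero c

/-- **v10 stub `[Unr]` BY NAME, modulo PUB.**  `RoadBHelpers.GL1InputUnramified` ([P1] of
`Theorems/…InterludeRoadBGL1Reduction`, = the type of the registered stub `stub_gl1InputUnramified` of skeleton v10) from the two
named facts; dictionary `RoadBHelpers.mem_everywhereUnramified_iff`.  CONDITIONAL on the two displayed published theorems.
[cite: FerreroWashington1979, Theorem] [cite: Washington1997, §13.5 Prop. 13.28] -/
theorem gl1InputUnramified_of_ferreroWashington
    (hFW : ferreroWashington1979_classicalMuVanishes) (hU : classicalMuVanishes_finite_unramifiedClasses) :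
    RoadBHelpers.GL1InputUnramified := by
  intro K _ _ hK p _ hp2 κ hκ M _ _ _ _ _ hcard hM
  exact (unrInput_of_ferreroWashington hFW hU K hK p hp2 κ hκ M hcard hM).subset fun c hc ↦
    (RoadBHelpers.mem_everywhereUnramified_iff c).1 hc

/-- **(B3) BY NAME from PUB ∧ [Even].**  `InterludeWithTorsion.ResidualGL1FinitenessOdd` (the registered (B3) currency of
`Theorems/…InterludeDefs`) from the two named facts of classical Iwasawa theory and W2's `[Even]` input (Greenberg LNM 1716
Lemma 5.9 over `K_∞`, via `cycSwapH1`), through `residualGL1FinitenessOdd_of_unr_even'` (`Theorems/…InterludeResidualGL1Tame`).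
(B3) is REDUCED to PUB ∧ [Even], not proved. [cite: GreenbergLNM1716, §5 Lemma 5.9] [cite: FerreroWashington1979, Theorem] -/
theorem residualGL1FinitenessOdd_of_ferreroWashington_even
    (hFW : ferreroWashington1979_classicalMuVanishes) (hU : classicalMuVanishes_finite_unramifiedClasses)
    (hEven : ∀ (K : Type) [Field K] [NumberField K] [IsGalois ℚ K], IsImaginaryQuadratic K →
      ∀ (p : ℕ) [Fact p.Prime], p ≠ 2 →
      ∀ (κ : ZpExtension K p) (hκ : κ.IsCyclotomic),
      ∀ (M : Type) [AddCommGroup M] [DistribMulAction (absoluteGaloisGroup ℚ) M]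
        [DistribMulAction (absoluteGaloisGroup K) M] [TopologicalSpace M] [DiscreteTopology M],
        Nat.card M = p →
        ∀ (hM : ∀ (σ : absoluteGaloisGroup K) (m : M), σ • m = (absGaloisRestrict ℚ K σ) • m),
        ∃ τ : absoluteGaloisGroup ℚ, τ ∉ Set.range (absGaloisRestrict ℚ K) ∧
          (((fun c ↦ c + cycSwapH1 κ hκ M hM τ c) ''
              (unramifiedOutside κ.kerSubgroup M p ∅ : Set (subgroupH1 κ.kerSubgroup M))).Finite ∨
            ((fun c ↦ c - cycSwapH1 κ hκ M hM τ c) ''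
              (unramifiedOutside κ.kerSubgroup M p ∅ : Set (subgroupH1 κ.kerSubgroup M))).Finite)) :
    InterludeWithTorsion.ResidualGL1FinitenessOdd :=
  residualGL1FinitenessOdd_of_unr_even' (unrInput_of_ferreroWashington hFW hU) hEven

end Assembly

end Summit.BirchSwinnertonDyer.BirchSwinnertonDyer.Theorems.InterludeWithTorsion.UnrTransport

end
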